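import Summits.AtomisticToContinuum.Crystallization.Theorems.ChartedZeroExcessLayeredLatticeLiouvilleYQ

/-!
# Part YR «ResidualSplit» (lens-2 g70): the residual leaf (Res) by NEAR / FAR SPLIT of the reference load, (Res) ⟸ (Rn) ∧ (Rt)

Docket `stmt-AtomisticToContinuum-26636` (N = `…Theses.ChartedPlanarOrder.ChartedZeroExcessLayered`), cell decomp-a2c RESIDUAL MODE, lens-2
«structural dichotomy (special vs generic)», generation 70.  Node beneath the ATTACKABLE piece (Res) `ReferenceLoadP` of part YQ «FluxResponse» v2
(g69, landed p852420; critic rows 1272 (F) / 1274 (d): "split (Res) into near and far FIRST").  First order; the junction is PROVED; imports part YQ only.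

## The node

  (Res) `ReferenceLoadP … Rg sb dI dB Rφ εg εI εb …`
    ⟸ (Rn) `NearReferenceLoadP … Rg sb dI dB Rφ ng nI nb Rf …`   [KINEMATIC-ANALYTIC · ATTACKABLE · INSTRUMENTABLE «RefLoad-T(near)» · carries the
                                                                   collar misfit AND the reference's own roughness — priced by the CHOICE of reference]
     ∧ (Rt) `FarReferenceLoadP … Rg sb dI dB Rφ tg tI tb Rf …`     [ANALYTIC · ATTACKABLE · WEAKER (a far-field tail bound over arbitrary door sets
                                                                   beyond `Rf`; continuum estimate in hand, g69 addendum 1)]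
     ∧ `ng + tg ≤ εg`, `nI + tI ≤ εI`, `nb + tb ≤ εb`              [arithmetic]
  junction `referenceLoadP_of_near_far` PROVED (both pieces and the arithmetic load-bearing; `Rf`, `Rφ` and all levels free).

* THE CUT is the tree's near / far split of the clamped energy about the container centre `x₀` at range `Rf` (part YJB:
  `clampedEnergy X = nearClampedEnergy X x₀ Rf + farClampedEnergy X x₀ Rf`, `clampedEnergy_eq_near_add_far`, summability from the door set):
  the reference's residual `φ₀ = D(clampedEnergy X)(y₀)` (`X = S ∖ core`) is `φn + φt` with `φn := D(near)(y₀)` — the core's self-interaction and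
  its interaction with the frozen field INSIDE `B̄(x₀, Rf)` (the cold collar, where the registry misfit lives, and every short bond of the reference,
  where its roughness lives) — and `φt := D(far)(y₀) = φ₀ − φn`, the load exerted by the frozen field OUTSIDE `B̄(x₀, Rf)`: an ARBITRARY θ-good door
  set at distance `> Rf − (q + ρ)` from every core site.  Levels add (`HasTubeFluxLoad.add`, part YQ).
* (Rn) is an `∃ φn`-statement (it carries the differentiability of the near energy at the reference — a finite-range functional once
  `X ∩ B̄(x₀, Rf)` is finite); (Rt) is a `∀ φt`-statement (every derivative of the far energy at `y₀` is small): so the junction needs no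
  differentiability lemma — `far = clamped − near` is differentiated from the binders.
* WHY `Rf = q + r + rsh` (record `4 + 8 + 12 = 24`; geometry PROVED in §YR-3): the cool moat `moatIn S K r (r + rsh)` lies in the OPEN ball
  `B(x₀, q + r + rsh)` (`moatIn_subset_ball`), so at `Rf ≥ q + r + rsh` the near part sees the whole collar and the far field consists of sites
  beyond the moat's outer radius about which the binders say nothing but door-set goodness; and a far site is `> Rf − (q + ρ)` from every core
  site (`lt_dist_of_mem_coreOf_of_not_mem_closedBall`; record `24 − 20 = 4 = D`, the far-field table of g69 addendum 1: net force per interface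
  site `≈ 0.0019`, `≤ 1.4·10⁻⁴` at `D = 8`).  A smaller `Rf` puts collar sites adjacent to rim core sites into the far part (far load not small);
  a larger `Rf` only moves known-cold sites into (Rn).
* NO THIRD «roughness» SUMMAND (g69 plan revised): the reference's own roughness is a property of the CHOICE of `y₀`, which (XR) makes; it is
  priced inside (Rn) (bond-flux class `ng`), and the honest statement is that (Rn) is small only for references that are (near-)registered to the
  chart lattice along the collar — see the module docstring of part YS, §«reference class», for the refinement this suggests to the g71 planner.

## Lens reading (special vs generic)
GENERIC = the far field: arbitrary door-set clutter beyond `Rf`, entering only through a decaying, sign-indefinite pair tail whose class levels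
are small by distance alone (interface-dominated, `∝ D⁻⁴` net of the continuum cancellation).  SPECIAL = the near field: the registered cold collar
and the reference's own bonds, where the load is structured (registry misfit, coherent along the interface) and must be met by the structured
(interface-class) response constants of (G∞).  The split is exhaustive by `near + far = clamped` (PROVED).

## Dials (census decides — «RefLoad-T» split: minimal class levels of `D(near)(y₀)` and of `D(far)(y₀)` per sampled core at `Rf = 24`, one LP
each; pre-registered forecast: near interface level `≈ 15·ϑm–0.011`, near bond level `≈ 10.6·ϑ₀` for a `ϑ₀`-rough reference and `≈ 0` for a
registered one, far levels `≈ (0, 0.002, 10⁻⁴)`)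
Record geometry only (`loadedTubeAprioriP_record_of_nearFar`, `nearFar_dial_record`): `Rf := 24`; `Rφ`, the matrix and all levels SYMBOLIC.
(Rn)/(Rt) are WEAKER for larger levels (`.of_le`), a larger flux radius (`.of_radius_le`) and a colder moat (`.of_moat_le`) — PROVED.

## Why each piece might fail
(Rn): registry-coherent collar misfit `> 2ϑc` per exterior bond at under-coordinated collar stars; a `ϑ₀`-tame but unregistered reference costs
`≈ 10.6·ϑ₀` of bond flux (at `ϑ₀ = 1/400` this alone exceeds every feasible budget — the record corollary at `ϑ₀ = 1/400` is expected to close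
only vacuously; the live instance is the symbolic-`ϑ₀` slot `nearFar_tubeSlot`).  (Rt): one-sided clustering of the far door set above lattice
density within a few shells of `Rf` (the tail is absolutely convergent, `Σ r⁻⁷·r²`, so only the first shells matter); non-differentiability is
not an issue ((Rt) quantifies over derivatives).

## Sources
part YJB (near/far split, far-field second-difference bound); part YQ v2 ((Res), currency, `HasTubeFluxLoad.add`); g69 NODE addendum 1 (far-field
table); E–Ming, ARMA 183 (2007) §2; Ortner–Shapeev arXiv:1204.3705 §4 (residuals in divergence form); Ehrlacher–Ortner–Shapeev, ARMA 222 (2016)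
(far-field decay of defect residuals); CRITIC-LEDGER rows 1272 (F), 1274 (d).  0 sorry; standard axioms.
-/

noncomputable section
open scoped BigOperators Classical InnerProductSpace RealInnerProductSpace
open MeasureTheory Set Metric Filter Topology
open Summit.AtomisticToContinuum.Crystallization.Theorems.ChartedPlanarOrderRigidityDoor (E3 eStar atomsIn IsEStarGSC siteEnergy VisibleGap PertRegime)
open Summit.AtomisticToContinuum.Crystallization.Theorems.ChartedPlanarOrderDensityDichotomy (μS IsSep nK nK_nonneg)
open Summit.AtomisticToContinuum.Crystallization.Theorems.ChartedPlanarOrderCleanScaleP (IsCleanP IsDoorSetP)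
open Summit.AtomisticToContinuum.Crystallization.Theorems.ChartedPlanarOrderMesoCut (LayeredHom EnvClose)
open Summit.AtomisticToContinuum.Crystallization.Theorems.ChartedPlanarOrderDoorLayered (atomsIn_subset sq_le_finsum_mem PeriodicBulkGapDoor)
open Summit.AtomisticToContinuum.Crystallization.Theorems.ChartedPlanarOrderDoorLayeredOsc (IsTwoShellAffineGood)
open Literature.MathematicalPhysics.StatisticalMechanics (card_le_of_separated_of_dist_le lennardJones interactionEnergy)

namespace Summit.AtomisticToContinuum.Crystallization.Theorems.ChartedZeroExcessLayeredLatticeLiouville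

/-! ### YR-1  The two pieces (Rn) / (Rt) (typed; binders of (Res) verbatim; levels, flux radius and far-field radius symbolic) -/

section ResidualSplit

/-- ★★ **(Rn) «NearReferenceLoadP … Rg sb dI dB Rφ ng nI nb Rf …» — THE NEAR PART OF THE REFERENCE LOAD HAS SMALL CLASS LEVELS.**  Under the
binders of (Res) verbatim, for every tube reference `y₀`: the near energy `z ↦ nearClampedEnergy (S ∖ core) x₀ Rf z` (the core's self-interaction
plus its pair sums against the frozen field inside `B̄(x₀, Rf)`) is differentiable at `y₀` with a derivative `φn` of class levels `(ng, nI, nb)`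
about `y₀` (flux radius `Rφ`).  Here live the COLLAR MISFIT (interface class) and the reference's OWN ROUGHNESS (bond-flux class).
KINEMATIC-ANALYTIC · ATTACKABLE · WEAKER than (Res) at `Rf < ∞` only together with (Rt) · INSTRUMENTABLE «RefLoad-T(near)».
Why it might fail: registry-coherent collar misfit `> 2ϑc` per exterior bond; an unregistered `ϑ₀`-tame reference costs `≈ 10.6·ϑ₀` of bond flux
(the piece is small only for references registered to the chart lattice along the collar — a property of the witness of (XR), not of the class).
Sources: part YQ (Res); part YJB; Ortner–Shapeev arXiv:1204.3705 §4; CRITIC-LEDGER rows 1272 (F), 1274 (d). [this file, g70] -/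
def NearReferenceLoadP (ϑc ϑ ϑp r q rsh ρ rm dm ϑ₀ Rg sb dI dB Rφ ng nI nb Rf aHi Λ θ s : ℝ) : Prop :=
  ∀ δ : ℝ, 0 < δ → ∀ a : ℝ, 0 < a →
    ∀ S : Set E3, IsDoorSetP aHi δ S → (∀ z : E3, Summable fun y : S => lennardJones (dist z (y : E3))) →
      (∀ p ∈ S, IsTwoShellAffineGood θ S p) →
        ∀ (L : E3 ≃L[ℝ] E3) (w : ℤ → E3), IsEquilChart a s Λ L w →
          ∀ (x₀ : E3) (K : Set E3), K ⊆ S → (∀ k ∈ K, dist k x₀ ≤ q) →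
            IsTameOn ϑp S (LayeredHom (L : E3 →L[ℝ] E3) w) (coreOf S K rm) →
              IsTameOn ϑc S (LayeredHom (L : E3 →L[ℝ] E3) w) (moatIn S K r (r + rsh)) →
                ∀ (n : ℕ) (xf : Fin n → E3), Function.Injective xf → Set.range xf = coreOf S K ρ →
                  ∀ y₀ : Fin n → E3, IsTubeReference ϑ₀ ϑ dm Rg sb dI dB (S \ coreOf S K ρ) (LayeredHom (L : E3 →L[ℝ] E3) w) xf y₀ →
                    ∃ φn : (Fin n → E3) →L[ℝ] ℝ,
                      HasFDerivAt (fun z : Fin n → E3 => nearClampedEnergy (S \ coreOf S K ρ) x₀ Rf z) φn y₀ ∧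
                        HasTubeFluxLoad (S \ coreOf S K ρ) Rg Rφ ng nI nb y₀ φn

/-- ★★ **(Rt) «FarReferenceLoadP … Rg sb dI dB Rφ tg tI tb Rf …» — THE FAR-FIELD LOAD ON THE REFERENCE HAS SMALL CLASS LEVELS.**  Under the
binders of (Res) verbatim, for every tube reference `y₀`: EVERY derivative `φt` at `y₀` of the far energy `z ↦ farClampedEnergy (S ∖ core) x₀ Rf z`
(the core's pair sums against the frozen field OUTSIDE `B̄(x₀, Rf)` — an arbitrary θ-good `aHi`-door set, each of its sites `> Rf − (q + ρ)` from
every core site, §YR-3) has class levels `(tg, tI, tb)` about `y₀`.  THE TAIL: absolutely convergent (`V′ ∼ r⁻⁷`), interface-dominated after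
the continuum cancellation (g69 addendum 1: net force `≈ 0.0019` per interface site at `D = 4`, `≤ 1.4·10⁻⁴` at `D = 8`).
ANALYTIC · ATTACKABLE · WEAKER than (Res) · INSTRUMENTABLE «RefLoad-T(far)».
Why it might fail: one-sided clustering of the far door set above lattice density in the first shells beyond `Rf` (door-set density bounds
control it; the sign-indefinite cancellation does not survive adversarial clustering, the absolute bound does).
Sources: part YJB (far-field bound); g69 NODE addendum 1; E–Ming 2007 §2; Ehrlacher–Ortner–Shapeev 2016. [this file, g70] -/
def FarReferenceLoadP (ϑc ϑ ϑp r q rsh ρ rm dm ϑ₀ Rg sb dI dB Rφ tg tI tb Rf aHi Λ θ s : ℝ) : Prop :=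
  ∀ δ : ℝ, 0 < δ → ∀ a : ℝ, 0 < a →
    ∀ S : Set E3, IsDoorSetP aHi δ S → (∀ z : E3, Summable fun y : S => lennardJones (dist z (y : E3))) →
      (∀ p ∈ S, IsTwoShellAffineGood θ S p) →
        ∀ (L : E3 ≃L[ℝ] E3) (w : ℤ → E3), IsEquilChart a s Λ L w →
          ∀ (x₀ : E3) (K : Set E3), K ⊆ S → (∀ k ∈ K, dist k x₀ ≤ q) →
            IsTameOn ϑp S (LayeredHom (L : E3 →L[ℝ] E3) w) (coreOf S K rm) →
              IsTameOn ϑc S (LayeredHom (L : E3 →L[ℝ] E3) w) (moatIn S K r (r + rsh)) →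
                ∀ (n : ℕ) (xf : Fin n → E3), Function.Injective xf → Set.range xf = coreOf S K ρ →
                  ∀ y₀ : Fin n → E3, IsTubeReference ϑ₀ ϑ dm Rg sb dI dB (S \ coreOf S K ρ) (LayeredHom (L : E3 →L[ℝ] E3) w) xf y₀ →
                    ∀ φt : (Fin n → E3) →L[ℝ] ℝ,
                      HasFDerivAt (fun z : Fin n → E3 => farClampedEnergy (S \ coreOf S K ρ) x₀ Rf z) φt y₀ →
                        HasTubeFluxLoad (S \ coreOf S K ρ) Rg Rφ tg tI tb y₀ φt

/-! ### YR-2  THE JUNCTION (PROVED): (Res) ⟸ (Rn) ∧ (Rt) ∧ arithmetic; dials -/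

/-- ★★★ **THE JUNCTION (PROVED): (Rn)(Rf; n) ∧ (Rt)(Rf; t) ∧ `ng + tg ≤ εg` ∧ `nI + tI ≤ εI` ∧ `nb + tb ≤ εb` ⇒ (Res)(ε).**  `clampedEnergy = near + far`
(`clampedEnergy_eq_near_add_far`, summability over `S ∖ core ⊆ S` from the binders), so `far = clamped − near` has derivative `φ₀ − φn` at `y₀`;
(Rt) bounds it, (Rn) bounds `φn`, and levels add (`HasTubeFluxLoad.add`): `φ₀ = φn + (φ₀ − φn)`. [this file, g70] -/
theorem referenceLoadP_of_near_far {ϑc ϑ ϑp r q rsh ρ rm dm ϑ₀ Rg sb dI dB Rφ ng nI nb tg tI tb εg εI εb Rf aHi Λ θ s : ℝ}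
    (hg : ng + tg ≤ εg) (hI : nI + tI ≤ εI) (hB : nb + tb ≤ εb)
    (hn : NearReferenceLoadP ϑc ϑ ϑp r q rsh ρ rm dm ϑ₀ Rg sb dI dB Rφ ng nI nb Rf aHi Λ θ s)
    (ht : FarReferenceLoadP ϑc ϑ ϑp r q rsh ρ rm dm ϑ₀ Rg sb dI dB Rφ tg tI tb Rf aHi Λ θ s) :
    ReferenceLoadP ϑc ϑ ϑp r q rsh ρ rm dm ϑ₀ Rg sb dI dB Rφ εg εI εb aHi Λ θ s := by
  intro δ hδ a ha S hS hsum hgood L w hLw x₀ K hKS hKq hmild hcool n xf hxf hrange y₀ hy₀ φ₀ hφ₀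
  obtain ⟨φn, hφn, hln⟩ := hn δ hδ a ha S hS hsum hgood L w hLw x₀ K hKS hKq hmild hcool n xf hxf hrange y₀ hy₀
  have hE : ∀ z : Fin n → E3, farClampedEnergy (S \ coreOf S K ρ) x₀ Rf z
      = clampedEnergy (S \ coreOf S K ρ) z - nearClampedEnergy (S \ coreOf S K ρ) x₀ Rf z := by
    intro z
    rw [clampedEnergy_eq_near_add_far (S \ coreOf S K ρ) x₀ Rf z
      (fun i => summable_coe_subset (f := fun p => lennardJones (dist (z i) p)) Set.sdiff_subset (hsum (z i)))]
    ring
  have hφt : HasFDerivAt (fun z : Fin n → E3 => farClampedEnergy (S \ coreOf S K ρ) x₀ Rf z) (φ₀ - φn) y₀ :=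
    (hφ₀.sub hφn).congr_of_eventuallyEq (Filter.Eventually.of_forall fun z => hE z)
  have hlt := ht δ hδ a ha S hS hsum hgood L w hLw x₀ K hKS hKq hmild hcool n xf hxf hrange y₀ hy₀ (φ₀ - φn) hφt
  have key : HasTubeFluxLoad (S \ coreOf S K ρ) Rg Rφ εg εI εb y₀ (φn + (φ₀ - φn)) := (hln.add hlt).mono hg hI hB
  simpa using key

/-- **DIAL (PROVED): (Rn) is WEAKER for larger levels.** [this file, g70] -/
theorem NearReferenceLoadP.of_le {ϑc ϑ ϑp r q rsh ρ rm dm ϑ₀ Rg sb dI dB Rφ ng nI nb ng' nI' nb' Rf aHi Λ θ s : ℝ}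
    (hg : ng ≤ ng') (hI : nI ≤ nI') (hB : nb ≤ nb') (hn : NearReferenceLoadP ϑc ϑ ϑp r q rsh ρ rm dm ϑ₀ Rg sb dI dB Rφ ng nI nb Rf aHi Λ θ s) :
    NearReferenceLoadP ϑc ϑ ϑp r q rsh ρ rm dm ϑ₀ Rg sb dI dB Rφ ng' nI' nb' Rf aHi Λ θ s := by
  intro δ hδ a ha S hS hsum hgood L w hLw x₀ K hKS hKq hmild hcool n xf hxf hrange y₀ hy₀
  obtain ⟨φn, hφn, hln⟩ := hn δ hδ a ha S hS hsum hgood L w hLw x₀ K hKS hKq hmild hcool n xf hxf hrange y₀ hy₀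
  exact ⟨φn, hφn, hln.mono hg hI hB⟩

/-- **DIAL (PROVED): (Rn) is WEAKER for a larger flux radius.** [this file, g70] -/
theorem NearReferenceLoadP.of_radius_le {ϑc ϑ ϑp r q rsh ρ rm dm ϑ₀ Rg sb dI dB Rφ Rφ' ng nI nb Rf aHi Λ θ s : ℝ} (hR : Rφ ≤ Rφ')
    (hn : NearReferenceLoadP ϑc ϑ ϑp r q rsh ρ rm dm ϑ₀ Rg sb dI dB Rφ ng nI nb Rf aHi Λ θ s) :
    NearReferenceLoadP ϑc ϑ ϑp r q rsh ρ rm dm ϑ₀ Rg sb dI dB Rφ' ng nI nb Rf aHi Λ θ s := by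
  intro δ hδ a ha S hS hsum hgood L w hLw x₀ K hKS hKq hmild hcool n xf hxf hrange y₀ hy₀
  obtain ⟨φn, hφn, hln⟩ := hn δ hδ a ha S hS hsum hgood L w hLw x₀ K hKS hKq hmild hcool n xf hxf hrange y₀ hy₀
  exact ⟨φn, hφn, hln.radius_mono hR⟩

/-- **DIAL (PROVED): (Rn) is WEAKER at a colder moat** (`ϑm ≤ ϑc`). [this file, g70] -/
theorem NearReferenceLoadP.of_moat_le {ϑm ϑc ϑ ϑp r q rsh ρ rm dm ϑ₀ Rg sb dI dB Rφ ng nI nb Rf aHi Λ θ s : ℝ} (h : ϑm ≤ ϑc)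
    (hn : NearReferenceLoadP ϑc ϑ ϑp r q rsh ρ rm dm ϑ₀ Rg sb dI dB Rφ ng nI nb Rf aHi Λ θ s) :
    NearReferenceLoadP ϑm ϑ ϑp r q rsh ρ rm dm ϑ₀ Rg sb dI dB Rφ ng nI nb Rf aHi Λ θ s :=
  fun δ hδ a ha S hS hsum hgood L w hLw x₀ K hKS hKq hmild hcool =>
    hn δ hδ a ha S hS hsum hgood L w hLw x₀ K hKS hKq hmild (IsTameOn.mono h Subset.rfl hcool)

/-- **DIAL (PROVED): (Rt) is WEAKER for larger levels.** [this file, g70] -/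
theorem FarReferenceLoadP.of_le {ϑc ϑ ϑp r q rsh ρ rm dm ϑ₀ Rg sb dI dB Rφ tg tI tb tg' tI' tb' Rf aHi Λ θ s : ℝ}
    (hg : tg ≤ tg') (hI : tI ≤ tI') (hB : tb ≤ tb') (ht : FarReferenceLoadP ϑc ϑ ϑp r q rsh ρ rm dm ϑ₀ Rg sb dI dB Rφ tg tI tb Rf aHi Λ θ s) :
    FarReferenceLoadP ϑc ϑ ϑp r q rsh ρ rm dm ϑ₀ Rg sb dI dB Rφ tg' tI' tb' Rf aHi Λ θ s :=
  fun δ hδ a ha S hS hsum hgood L w hLw x₀ K hKS hKq hmild hcool n xf hxf hrange y₀ hy₀ φt hφt =>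
    (ht δ hδ a ha S hS hsum hgood L w hLw x₀ K hKS hKq hmild hcool n xf hxf hrange y₀ hy₀ φt hφt).mono hg hI hB

/-- **DIAL (PROVED): (Rt) is WEAKER for a larger flux radius.** [this file, g70] -/
theorem FarReferenceLoadP.of_radius_le {ϑc ϑ ϑp r q rsh ρ rm dm ϑ₀ Rg sb dI dB Rφ Rφ' tg tI tb Rf aHi Λ θ s : ℝ} (hR : Rφ ≤ Rφ')
    (ht : FarReferenceLoadP ϑc ϑ ϑp r q rsh ρ rm dm ϑ₀ Rg sb dI dB Rφ tg tI tb Rf aHi Λ θ s) :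
    FarReferenceLoadP ϑc ϑ ϑp r q rsh ρ rm dm ϑ₀ Rg sb dI dB Rφ' tg tI tb Rf aHi Λ θ s :=
  fun δ hδ a ha S hS hsum hgood L w hLw x₀ K hKS hKq hmild hcool n xf hxf hrange y₀ hy₀ φt hφt =>
    (ht δ hδ a ha S hS hsum hgood L w hLw x₀ K hKS hKq hmild hcool n xf hxf hrange y₀ hy₀ φt hφt).radius_mono hR

/-- **DIAL (PROVED): (Rt) is WEAKER at a colder moat** (`ϑm ≤ ϑc`). [this file, g70] -/
theorem FarReferenceLoadP.of_moat_le {ϑm ϑc ϑ ϑp r q rsh ρ rm dm ϑ₀ Rg sb dI dB Rφ tg tI tb Rf aHi Λ θ s : ℝ} (h : ϑm ≤ ϑc)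
    (ht : FarReferenceLoadP ϑc ϑ ϑp r q rsh ρ rm dm ϑ₀ Rg sb dI dB Rφ tg tI tb Rf aHi Λ θ s) :
    FarReferenceLoadP ϑm ϑ ϑp r q rsh ρ rm dm ϑ₀ Rg sb dI dB Rφ tg tI tb Rf aHi Λ θ s :=
  fun δ hδ a ha S hS hsum hgood L w hLw x₀ K hKS hKq hmild hcool =>
    ht δ hδ a ha S hS hsum hgood L w hLw x₀ K hKS hKq hmild (IsTameOn.mono h Subset.rfl hcool)

/-! ### YR-3  THE GEOMETRY OF THE CUT (PROVED): the moat lies inside `B(x₀, q + ℓ)`, the core inside `B̄(x₀, q + ρ)`, far sites are `> Rf − (q + ρ)`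
from every core site; record `Rf = 24 = q + r + rsh`, `D = 4` -/

/-- the moat of a container `K ⊆ B̄(x₀, q)` with outer radius `ℓ` lies in the OPEN ball `B(x₀, q + ℓ)`. [this file, g70] -/
theorem moatIn_subset_ball {S K : Set E3} {x₀ : E3} {q r₀ ℓ : ℝ} (hKq : ∀ k ∈ K, dist k x₀ ≤ q) : moatIn S K r₀ ℓ ⊆ ball x₀ (q + ℓ) := by
  intro p hp
  obtain ⟨-, ⟨y, hyK, hpy⟩, -⟩ := hp
  rw [mem_ball]
  calc dist p x₀ ≤ dist p y + dist y x₀ := dist_triangle p y x₀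
    _ < ℓ + q := add_lt_add_of_lt_of_le hpy (hKq y hyK)
    _ = q + ℓ := add_comm ℓ q

/-- the `ρ`-core of a container `K ⊆ B̄(x₀, q)` lies in the closed ball `B̄(x₀, q + ρ)`. [this file, g70] -/
theorem coreOf_subset_closedBall {S K : Set E3} {x₀ : E3} {q ρ : ℝ} (hKq : ∀ k ∈ K, dist k x₀ ≤ q) : coreOf S K ρ ⊆ closedBall x₀ (q + ρ) := by
  intro p hp
  obtain ⟨-, k, hkK, hpk⟩ := hp
  rw [mem_closedBall]
  calc dist p x₀ ≤ dist p k + dist k x₀ := dist_triangle p k x₀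
    _ ≤ ρ + q := add_le_add hpk (hKq k hkK)
    _ = q + ρ := add_comm ρ q

/-- ★ a FAR site (outside `B̄(x₀, Rf)`) is farther than `Rf − (q + ρ)` from every site of the `ρ`-core. [this file, g70] -/
theorem lt_dist_of_mem_coreOf_of_not_mem_closedBall {S K : Set E3} {x₀ : E3} {q ρ Rf : ℝ} (hKq : ∀ k ∈ K, dist k x₀ ≤ q)
    {c p : E3} (hc : c ∈ coreOf S K ρ) (hp : p ∉ closedBall x₀ Rf) : Rf - (q + ρ) < dist p c := by
  have hcx : dist c x₀ ≤ q + ρ := coreOf_subset_closedBall hKq hc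
  have hpx : Rf < dist p x₀ := lt_of_not_ge fun h => hp (mem_closedBall.2 h)
  have htri : dist p x₀ ≤ dist p c + dist c x₀ := dist_triangle p c x₀
  linarith

/-- ★ **THE RECORD CUT (PROVED)**: at the record radii `(r, q, rsh, ρ) = (8, 4, 12, 16)` and `Rf = 24`: the cool moat `moatIn S K 8 (8 + 12)` lies in the
open ball `B(x₀, 24)` — the near part at `Rf = 24` sees the WHOLE collar — and every far site (outside `B̄(x₀, 24)`) is MORE THAN `D = 4` from every
site of the `16`-core (two lattice shells: the far-field table of g69 addendum 1 applies). [this file, g70] -/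
theorem record_cut_geometry {S K : Set E3} {x₀ : E3} (hKq : ∀ k ∈ K, dist k x₀ ≤ 4) :
    moatIn S K 8 (8 + 12) ⊆ ball x₀ 24 ∧ ∀ c ∈ coreOf S K 16, ∀ p ∉ closedBall x₀ (24 : ℝ), 4 < dist p c := by
  refine ⟨fun p hp => ?_, fun c hc p hp => ?_⟩
  · have h := moatIn_subset_ball (r₀ := 8) (ℓ := 8 + 12) hKq hp
    norm_num at h ⊢
    exact h
  · have h := lt_dist_of_mem_coreOf_of_not_mem_closedBall (ρ := 16) (Rf := 24) hKq hc hp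
    norm_num at h
    exact h

/-! ### YR-4  The record-geometry corollaries (PROVED; `Rf := 24`; flux radius, matrix and levels SYMBOLIC) -/

/-- ★ **THE RECORD GEOMETRY (PROVED)**: at the record's moat/fill/core tameness `(1/2000, 1/100, 1/10)`, radii `8 4 12 16 16`, `dm = 1/2`, `ϑ₀ = 1/400`,
`Rg = 5`, outer tube `(3/400, 3/400, 3/10)`, far-field radius `Rf = 24`: (G∞)(Rφ; C) ∧ (Rn)(Rφ; n; 24) ∧ (Rt)(Rφ; t; 24) ∧
`Σ_c C_{k,c}·(n_c + t_c) ≤ (1/200, 1/200, 3/20)_k` give the `hA` slot of `loadPath_dial_instance` (part YO).  EXPECTED VACUOUS at `ϑ₀ = 1/400`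
(row s infeasible for unregistered references, see (Rn)); kept as the formal record — the live instance is `nearFar_tubeSlot`. [this file, g70] -/
theorem loadedTubeAprioriP_record_of_nearFar {Rφ CsG CsI CsB CIG CII CIB CBG CBI CBB ng nI nb tg tI tb : ℝ}
    (hng : 0 ≤ ng) (hnI : 0 ≤ nI) (hnb : 0 ≤ nb) (htg : 0 ≤ tg) (htI : 0 ≤ tI) (htb : 0 ≤ tb)
    (hs : CsG * (ng + tg) + CsI * (nI + tI) + CsB * (nb + tb) ≤ 1 / 200) (hI : CIG * (ng + tg) + CII * (nI + tI) + CIB * (nb + tb) ≤ 1 / 200)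
    (hB : CBG * (ng + tg) + CBI * (nI + tI) + CBB * (nb + tb) ≤ 3 / 20)
    (hG : TubeResponseP (1 / 2000) (1 / 100) (1 / 10) 8 4 12 16 16 (1 / 2) (1 / 400) 5 (3 / 400) (3 / 400) (3 / 10)
      Rφ CsG CsI CsB CIG CII CIB CBG CBI CBB 1 2 (1 / 16) (1 / 50))
    (hn : NearReferenceLoadP (1 / 2000) (1 / 100) (1 / 10) 8 4 12 16 16 (1 / 2) (1 / 400) 5 (3 / 400) (3 / 400) (3 / 10) Rφ ng nI nb 24
      1 2 (1 / 16) (1 / 50))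
    (ht : FarReferenceLoadP (1 / 2000) (1 / 100) (1 / 10) 8 4 12 16 16 (1 / 2) (1 / 400) 5 (3 / 400) (3 / 400) (3 / 10) Rφ tg tI tb 24
      1 2 (1 / 16) (1 / 50)) :
    LoadedTubeAprioriP (1 / 2000) (1 / 100) (1 / 10) 8 4 12 16 16 (1 / 2) (1 / 400) 5 (3 / 400) (3 / 400) (3 / 10)
      (1 / 200) (1 / 200) (3 / 20) 1 2 (1 / 16) (1 / 50) :=
  loadedTubeAprioriP_record_of_response (add_nonneg hng htg) (add_nonneg hnI htI) (add_nonneg hnb htb) hs hI hB hG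
    (referenceLoadP_of_near_far le_rfl le_rfl le_rfl hn ht)

/-- ★ **THE RECORD GEOMETRY through part YO (PROVED)**: (XR) ∧ (X1)(lam = 7/2000) at `ϑ₀ = 1/400` with (G∞) ∧ (Rn) ∧ (Rt) at `Rf = 24` and the three
inequalities ⇒ the existence leaf of the tube docket, via `response_dial_record`. [this file, g70] -/
theorem nearFar_dial_record {Rφ CsG CsI CsB CIG CII CIB CBG CBI CBB ng nI nb tg tI tb : ℝ}
    (hR : TubeReferenceP (1 / 2000) (1 / 100) (1 / 10) 8 4 12 16 16 (1 / 2) (1 / 400) 5 (3 / 400) (3 / 400) (3 / 10) 1 2 (1 / 16) (1 / 50))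
    (hC : TubeConvexityP (1 / 2000) (1 / 100) (1 / 10) 8 4 12 16 16 (1 / 2) (1 / 400) 5 (3 / 400) (3 / 400) (3 / 10) (7 / 2000) 1 2 (1 / 16) (1 / 50))
    (hng : 0 ≤ ng) (hnI : 0 ≤ nI) (hnb : 0 ≤ nb) (htg : 0 ≤ tg) (htI : 0 ≤ tI) (htb : 0 ≤ tb)
    (hs : CsG * (ng + tg) + CsI * (nI + tI) + CsB * (nb + tb) ≤ 1 / 200) (hI : CIG * (ng + tg) + CII * (nI + tI) + CIB * (nb + tb) ≤ 1 / 200)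
    (hB : CBG * (ng + tg) + CBI * (nI + tI) + CBB * (nb + tb) ≤ 3 / 20)
    (hG : TubeResponseP (1 / 2000) (1 / 100) (1 / 10) 8 4 12 16 16 (1 / 2) (1 / 400) 5 (3 / 400) (3 / 400) (3 / 10)
      Rφ CsG CsI CsB CIG CII CIB CBG CBI CBB 1 2 (1 / 16) (1 / 50))
    (hn : NearReferenceLoadP (1 / 2000) (1 / 100) (1 / 10) 8 4 12 16 16 (1 / 2) (1 / 400) 5 (3 / 400) (3 / 400) (3 / 10) Rφ ng nI nb 24
      1 2 (1 / 16) (1 / 50))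
    (ht : FarReferenceLoadP (1 / 2000) (1 / 100) (1 / 10) 8 4 12 16 16 (1 / 2) (1 / 400) 5 (3 / 400) (3 / 400) (3 / 10) Rφ tg tI tb 24
      1 2 (1 / 16) (1 / 50)) :
    CoolMoatSlavedFillingP (1 / 2000) (1 / 100) (1 / 10) 8 4 12 16 16 (1 / 2) 1 2 (1 / 16) (1 / 50) :=
  loadPath_dial_instance hR hC (loadedTubeAprioriP_record_of_nearFar hng hnI hnb htg htI htb hs hI hB hG hn ht)

/-- ★★ **THE SYMBOLIC-`ϑ₀` SLOT (PROVED; the live instance)**: at the docket geometry `(r, q, rsh, ρ, rm) = (8, 4, 12, 16, 16)`, `dm = 1/2`,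
`(aHi, Λ, θ, s) = (1, 2, 1/16, 1/50)`, `Rf = 24`, with moat/fill/mild tameness `ϑm ϑf ϑp`, reference tameness `ϑ₀`, bond radius `Rg`, tube radii,
modulus, flux radius, matrix and levels ALL FREE: (XR) ∧ (X1)(lam > 0) ∧ (G∞)(C) ∧ (Rn)(n) ∧ (Rt)(t) ∧ `Σ_c C_{k,c}·(n_c + t_c) ≤ (sb₁, dI₁, dB₁)_k`,
`0 ≤ ρ₁ < ρᵒ` ⇒ the existence leaf `CoolMoatSlavedFillingP ϑm ϑf ϑp 8 4 12 16 16 (1/2) 1 2 (1/16) (1/50)` of the tube docket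
(`coolMoatSlavedFillingP_tubeSlot_of_loadPath`, part YO). [this file, g70] -/
theorem nearFar_tubeSlot {ϑm ϑf ϑp ϑ₀ Rg sb dI dB sb₁ dI₁ dB₁ lam Rφ CsG CsI CsB CIG CII CIB CBG CBI CBB ng nI nb tg tI tb : ℝ}
    (hlam : 0 < lam) (hsb : sb₁ < sb) (hdI : dI₁ < dI) (hdB : dB₁ < dB) (hsb₀ : 0 ≤ sb₁) (hdI₀ : 0 ≤ dI₁) (hdB₀ : 0 ≤ dB₁)
    (hng : 0 ≤ ng) (hnI : 0 ≤ nI) (hnb : 0 ≤ nb) (htg : 0 ≤ tg) (htI : 0 ≤ tI) (htb : 0 ≤ tb)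
    (hs : CsG * (ng + tg) + CsI * (nI + tI) + CsB * (nb + tb) ≤ sb₁) (hI : CIG * (ng + tg) + CII * (nI + tI) + CIB * (nb + tb) ≤ dI₁)
    (hB : CBG * (ng + tg) + CBI * (nI + tI) + CBB * (nb + tb) ≤ dB₁)
    (hR : TubeReferenceP ϑm ϑf ϑp 8 4 12 16 16 (1 / 2) ϑ₀ Rg sb dI dB 1 2 (1 / 16) (1 / 50))
    (hC : TubeConvexityP ϑm ϑf ϑp 8 4 12 16 16 (1 / 2) ϑ₀ Rg sb dI dB lam 1 2 (1 / 16) (1 / 50))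
    (hG : TubeResponseP ϑm ϑf ϑp 8 4 12 16 16 (1 / 2) ϑ₀ Rg sb dI dB Rφ CsG CsI CsB CIG CII CIB CBG CBI CBB 1 2 (1 / 16) (1 / 50))
    (hn : NearReferenceLoadP ϑm ϑf ϑp 8 4 12 16 16 (1 / 2) ϑ₀ Rg sb dI dB Rφ ng nI nb 24 1 2 (1 / 16) (1 / 50))
    (ht : FarReferenceLoadP ϑm ϑf ϑp 8 4 12 16 16 (1 / 2) ϑ₀ Rg sb dI dB Rφ tg tI tb 24 1 2 (1 / 16) (1 / 50)) :
    CoolMoatSlavedFillingP ϑm ϑf ϑp 8 4 12 16 16 (1 / 2) 1 2 (1 / 16) (1 / 50) :=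
  coolMoatSlavedFillingP_tubeSlot_of_loadPath hlam hsb hdI hdB hsb₀ hdI₀ hdB₀ hR hC
    (loadedTubeAprioriP_of_response (add_nonneg hng htg) (add_nonneg hnI htI) (add_nonneg hnb htb) hs hI hB hG
      (referenceLoadP_of_near_far le_rfl le_rfl le_rfl hn ht))

end ResidualSplit

end Summit.AtomisticToContinuum.Crystallization.Theorems.ChartedZeroExcessLayeredLatticeLiouville

end
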